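import Summits.Ventures.PercRepro.Night2T3LinesA

/-!
# PercRepro — the LINE-TYPE sets, part B: (L1) summed, (L2) the exact stays, (L3) the demand-free line subsets,
(L4) the weighted rises, and the grouping of the lines by their number of points in `G` (night-2 gen 3,
NIGHT-2-profile.md §3b–§3c).  Imports `Night2T3LinesA` only.
-/
namespace PercRepro.Star

open Finset ThmH SixFour GenQ

variable {α : Type*} [DecidableEq α] {M : Matroid α} [M.Finite]

/-- **(L1)**: `#Pc k (q−2) = Σ_{L ∈ lines M} C(|L ∩ G|, d − k + 2)·betaL M G L q` for `k < d`. -/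
theorem card_Pc_sub_two_eq (hs : Simple M) {G : Finset α} {q d k : ℕ} (hG : G ⊆ gr M)
    (hrG : M.eRk (G : Set α) = (q : ℕ∞)) (hq : 3 ≤ q) (hcard : G.card = q + d) (hk : k < d) :
    (Pc M G q k (q - 2)).card = ∑ L ∈ lines M, (L ∩ G).card.choose (d - k + 2) * betaL M G L q := by
  rw [Finset.card_eq_sum_card_fiberwise (f := fun S => lineOf M S) (t := lines M)
    (fun S hS => Finset.mem_coe.2 (lineOf_mem_lines hG (by omega) hS))]
  apply Finset.sum_congr rfl
  intro L hL
  exact card_filter_lineOf_eq hs hG hrG hq hcard hk hL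

/-! ## (L2): the stays of the line-type sets are the points of their line -/

/-- For a line-type `S` at level `k+1`, the stay moves are exactly the points of `lineOf S ∩ G` outside `S`. -/
theorem card_stay_filter_eq {G S : Finset α} {q k : ℕ} (hG : G ⊆ gr M)
    (hrG : M.eRk (G : Set α) = (q : ℕ∞)) (hS : S ∈ Pc M G q (k + 1) (q - 2)) :
    ((G \ S).filter (fun x => mTr M (insert x S) = q - 2)).card = ((lineOf M S ∩ G) \ S).card := by
  congr 1
  ext x
  have hS' := mem_Pc.1 hS
  have hSG := (mem_Rq.1 hS'.1).1
  simp only [Finset.mem_filter, Finset.mem_sdiff, Finset.mem_inter]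
  constructor
  · rintro ⟨⟨hxG, hxS⟩, hm⟩
    refine ⟨⟨?_, hxG⟩, hxS⟩
    unfold lineOf
    rw [mem_clF]
    by_contra hx
    have hr := (mem_Rq.1 (insert_mem_Rq hrG hS'.1 hxG)).2
    have hxcl : x ∈ M.closure (S : Set α) := by
      apply mem_closure_of_eRk_insert_le' (hG hxG)
      rw [hr, (mem_Rq.1 hS'.1).2]
    have := mTr_insert_add_one_le_of_notMem_closure (hSG.trans hG) (hG hxG) hxS hxcl hx
    rw [hm, hS'.2.2] at this
    omega
  · rintro ⟨⟨hxL, hxG⟩, hxS⟩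
    refine ⟨⟨hxG, hxS⟩, ?_⟩
    unfold lineOf at hxL
    rw [mem_clF] at hxL
    have := coloopsOf_insert_eq_of_mem_closure (hSG.trans hG) hxS hxL
    unfold mTr
    rw [this]
    exact hS'.2.2

/-- On the fiber of `L`: `|(L ∩ G) ∖ S| = |L ∩ G| − (d − k + 1)` for `S ∈ Pc (k+1) (q−2)` with `lineOf S = L`. -/
theorem card_inter_sdiff_eq {G S : Finset α} {q d k : ℕ} (hG : G ⊆ gr M)
    (hcard : G.card = q + d) (hq : 2 ≤ q) (hS : S ∈ Pc M G q (k + 1) (q - 2)) :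
    ((lineOf M S ∩ G) \ S).card = (lineOf M S ∩ G).card - (d - k + 1) := by
  have hS' := mem_Pc.1 hS
  have hSG := (mem_Rq.1 hS'.1).1
  have hsd := Finset.card_sdiff_of_subset hSG
  have hle := Finset.card_le_card hSG
  rw [hS'.2.1] at hsd
  -- `(L ∩ G) ∩ S = Z(S)`, of size `|S| − (q − 2) = d − k + 1`
  have hinter : (lineOf M S ∩ G) ∩ S = S \ coloopsOf M S := by
    ext y
    simp only [Finset.mem_inter, Finset.mem_sdiff]
    constructor
    · rintro ⟨⟨hyL, -⟩, hyS⟩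
      refine ⟨hyS, fun hyK => ?_⟩
      exact (Finset.mem_sdiff.1 (coloopsOf_subset_sdiff_lineOf hS hyK)).2 hyL
    · intro hy
      exact ⟨Finset.mem_inter.1 (sdiff_coloopsOf_subset_lineOf_inter hG hS (Finset.mem_sdiff.2 hy)), hy.1⟩
  have h1 := Finset.card_sdiff_add_card_inter (lineOf M S ∩ G) S
  rw [hinter, card_sdiff_coloopsOf, hS'.2.2] at h1
  have hSq : q ≤ S.card := le_card_of_eRk_eq (mem_Rq.1 hS'.1).2
  omega

/-- **(L2)**: `mv k (q−2) (q−2) = Σ_{L ∈ lines M} (|L ∩ G| − (d − k + 1))·C(|L ∩ G|, d − k + 1)·betaL M G L q`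
for `k + 1 < d`. -/
theorem mv_stay_sub_two_eq (hs : Simple M) {G : Finset α} {q d k : ℕ} (hG : G ⊆ gr M)
    (hrG : M.eRk (G : Set α) = (q : ℕ∞)) (hq : 3 ≤ q) (hcard : G.card = q + d) (hk : k + 1 < d) :
    mv M G q k (q - 2) (q - 2) =
      ∑ L ∈ lines M, ((L ∩ G).card - (d - k + 1)) * ((L ∩ G).card.choose (d - k + 1) * betaL M G L q) := by
  unfold mv
  rw [← Finset.sum_fiberwise_of_maps_to (s := Pc M G q (k + 1) (q - 2)) (t := lines M)
    (g := fun S => lineOf M S) (fun S hS => Finset.mem_coe.2 (lineOf_mem_lines hG (by omega) hS))]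
  apply Finset.sum_congr rfl
  intro L hL
  have hfib := card_filter_lineOf_eq hs hG hrG hq hcard hk hL
  have hdk : d - (k + 1) + 2 = d - k + 1 := by omega
  rw [hdk] at hfib
  rw [← hfib, Finset.card_eq_sum_ones ((Pc M G q (k + 1) (q - 2)).filter (fun S : Finset α => lineOf M S = L)),
    Finset.mul_sum]
  apply Finset.sum_congr rfl
  intro S hS
  have hS' := Finset.mem_filter.1 hS
  rw [card_stay_filter_eq hG hrG hS'.1, card_inter_sdiff_eq hG hcard (by omega) hS'.1, hS'.2, mul_one]

/-! ## (L3): the coindependent subsets of a line are demand-free -/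

/-- The subsets `A ⊆ L ∩ G` with `3 ≤ |A| ≤ |L ∩ G| − 2`. -/
noncomputable def lineSub (G L : Finset α) : Finset (Finset α) :=
  (L ∩ G).powerset.filter (fun A : Finset α => 3 ≤ A.card ∧ A.card + 2 ≤ (L ∩ G).card)

omit [M.Finite] in
/-- Membership in `lineSub`. -/
theorem mem_lineSub {G L A : Finset α} :
    A ∈ lineSub G L ↔ A ⊆ L ∩ G ∧ 3 ≤ A.card ∧ A.card + 2 ≤ (L ∩ G).card := by
  unfold lineSub
  rw [Finset.mem_filter, Finset.mem_powerset]

/-- For `A ∈ lineSub G L`, the set `G ∖ A` has rank `q` (the rest of the line spans `A`). -/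
theorem sdiff_mem_Rq_of_mem_lineSub (hs : Simple M) {G : Finset α} {q : ℕ} (hG : G ⊆ gr M)
    (hrG : M.eRk (G : Set α) = (q : ℕ∞)) {L : Finset α} (hL : L ∈ lines M) {A : Finset α}
    (hA : A ∈ lineSub G L) : G \ A ∈ Rq M G q := by
  obtain ⟨hAsub, hA3, hA2⟩ := mem_lineSub.1 hA
  have hAL : A ⊆ L := hAsub.trans Finset.inter_subset_left
  -- `(L ∩ G) ∖ A` has `≥ 2` points of `L`, so its closure is `L`
  have hsub : (L ∩ G) \ A ⊆ L := Finset.sdiff_subset.trans Finset.inter_subset_left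
  have hc2 : 2 ≤ ((L ∩ G) \ A).card := by
    have h := Finset.card_sdiff_of_subset hAsub
    omega
  have hcl := closure_eq_of_subset_line hL hsub (eRk_eq_two_of_subset_line hs hL hsub hc2)
  have hGcl : (G : Set α) ⊆ M.closure ((G \ A : Finset α) : Set α) := by
    intro y hy
    have hyG := Finset.mem_coe.1 hy
    have hyE : y ∈ M.E := by rw [← coe_gr M]; exact Finset.mem_coe.2 (hG hyG)
    by_cases hyA : y ∈ A
    · have hyL : y ∈ (L : Set α) := Finset.mem_coe.2 (hAL hyA)
      rw [← hcl] at hyL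
      exact M.closure_subset_closure
        (Finset.coe_subset.2 (Finset.sdiff_subset_sdiff Finset.inter_subset_right (Finset.Subset.refl A))) hyL
    · exact M.mem_closure_of_mem' (Finset.mem_coe.2 (Finset.mem_sdiff.2 ⟨hyG, hyA⟩)) hyE
  have h1 := M.eRk_mono hGcl
  rw [Matroid.eRk_closure_eq, hrG] at h1
  have h2 : M.eRk ((G \ A : Finset α) : Set α) ≤ (q : ℕ∞) := by
    rw [← hrG]; exact M.eRk_mono (Finset.coe_subset.2 Finset.sdiff_subset)
  exact mem_Rq.2 ⟨Finset.sdiff_subset, le_antisymm h2 h1⟩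

/-- **(L3)**: `Σ_{k ≤ 2} #C_k + Σ_{L ∈ lines M} #lineSub G L ≤ DF_3`. -/
theorem card_le_two_add_lines_le_DFq (hs : Simple M) {G : Finset α} {q : ℕ} (hG : G ⊆ gr M)
    (hrG : M.eRk (G : Set α) = (q : ℕ∞)) :
    ((Rq M G q).filter (fun S : Finset α => (G \ S).card ≤ 2)).card +
      ∑ L ∈ lines M, (lineSub G L).card ≤ DFq M G q 3 := by
  -- the images `G ∖ A`
  set B : Finset (Finset α) := (lines M).biUnion (fun L => (lineSub G L).image (fun A => G \ A)) with hB
  have hinj : ∀ L, Set.InjOn (fun A : Finset α => G \ A) ↑(lineSub G L) := by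
    intro L A hA A' hA' h
    have hAG : A ⊆ G := (mem_lineSub.1 hA).1.trans Finset.inter_subset_right
    have hA'G : A' ⊆ G := (mem_lineSub.1 hA').1.trans Finset.inter_subset_right
    have := congrArg (fun X => G \ X) h
    simp only [Finset.sdiff_sdiff_eq_self hAG, Finset.sdiff_sdiff_eq_self hA'G] at this
    exact this
  have hcardB : B.card = ∑ L ∈ lines M, (lineSub G L).card := by
    rw [hB, Finset.card_biUnion]
    · apply Finset.sum_congr rfl
      intro L _
      exact Finset.card_image_of_injOn (hinj L)
    · intro L hL L' hL' hne
      show Disjoint _ _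
      rw [Finset.disjoint_left]
      intro S hS hS'
      obtain ⟨A, hA, rfl⟩ := Finset.mem_image.1 hS
      obtain ⟨A', hA', hAA'⟩ := Finset.mem_image.1 hS'
      have hAG : A ⊆ G := (mem_lineSub.1 hA).1.trans Finset.inter_subset_right
      have hA'G : A' ⊆ G := (mem_lineSub.1 hA').1.trans Finset.inter_subset_right
      have heq : A' = A := by
        have := congrArg (fun X => G \ X) hAA'
        simp only [Finset.sdiff_sdiff_eq_self hAG, Finset.sdiff_sdiff_eq_self hA'G] at this
        exact this
      rw [heq] at hA'
      -- `A` has `≥ 3` points on both lines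
      have h3 := (mem_lineSub.1 hA).2.1
      obtain ⟨a, ha, b, hb, hab⟩ := Finset.one_lt_card.1 (by omega : 1 < A.card)
      have hAL : A ⊆ L := (mem_lineSub.1 hA).1.trans Finset.inter_subset_left
      have hAL' : A ⊆ L' := (mem_lineSub.1 hA').1.trans Finset.inter_subset_left
      exact hne (lines_eq_of_two_mem hs hL hL' (hAL ha) (hAL hb) (hAL' ha) (hAL' hb) hab)
  have hdisj : Disjoint ((Rq M G q).filter (fun S : Finset α => (G \ S).card ≤ 2)) B := by
    rw [Finset.disjoint_left]
    intro S hS hSB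
    obtain ⟨L, -, hSL⟩ := Finset.mem_biUnion.1 hSB
    obtain ⟨A, hA, rfl⟩ := Finset.mem_image.1 hSL
    have hAG : A ⊆ G := (mem_lineSub.1 hA).1.trans Finset.inter_subset_right
    have h3 := (mem_lineSub.1 hA).2.1
    have := (Finset.mem_filter.1 hS).2
    rw [Finset.sdiff_sdiff_eq_self hAG] at this
    omega
  rw [← hcardB, ← Finset.card_union_of_disjoint hdisj]
  unfold DFq
  apply Finset.card_le_card
  intro S hS
  rcases Finset.mem_union.1 hS with hS | hS
  · have hS' := Finset.mem_filter.1 hS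
    refine Finset.mem_filter.2 ⟨hS'.1, ?_⟩
    have h1 : M.eRk ((G \ S : Finset α) : Set α) ≤ 2 := by
      refine (M.eRk_le_encard _).trans ?_
      rw [Set.encard_coe_eq_coe_finsetCard]
      exact_mod_cast hS'.2
    calc M.eRk ((G \ S : Finset α) : Set α) + 1 ≤ 2 + 1 := add_le_add h1 le_rfl
      _ = ((3 : ℕ) : ℕ∞) := by norm_num
  · obtain ⟨L, hL, hSL⟩ := Finset.mem_biUnion.1 hS
    obtain ⟨A, hA, rfl⟩ := Finset.mem_image.1 hSL
    have hAG : A ⊆ G := (mem_lineSub.1 hA).1.trans Finset.inter_subset_right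
    have hAL : A ⊆ L := (mem_lineSub.1 hA).1.trans Finset.inter_subset_left
    refine Finset.mem_filter.2 ⟨sdiff_mem_Rq_of_mem_lineSub hs hG hrG hL hA, ?_⟩
    rw [Finset.sdiff_sdiff_eq_self hAG]
    have h1 : M.eRk (A : Set α) ≤ 2 := by
      rw [← (mem_lines.1 hL).2.2]
      exact M.eRk_mono (Finset.coe_subset.2 hAL)
    calc M.eRk (A : Set α) + 1 ≤ 2 + 1 := add_le_add h1 le_rfl
      _ = ((3 : ℕ) : ℕ∞) := by norm_num

/-! ## (L4): the weighted rises (absorption per class) -/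

/-- **(L4)**: `(m′ − m(G))·#Pc (k+1) m′ ≤ Σ_{m ∈ [m(G), m′]} (m′ − m)·mv k m′ m` (in `ℤ`). -/
theorem weighted_rises {G : Finset α} {q k m' : ℕ} (hG : G ⊆ gr M)
    (hrG : M.eRk (G : Set α) = (q : ℕ∞)) :
    ((m' : ℤ) - (mTr M G : ℤ)) * ((Pc M G q (k + 1) m').card : ℤ) ≤
      ∑ m ∈ Finset.Icc (mTr M G) m', ((m' : ℤ) - (m : ℤ)) * (mv M G q k m' m : ℤ) := by
  have key : ∀ S ∈ Pc M G q (k + 1) m', ((m' : ℤ) - (mTr M G : ℤ)) ≤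
      ∑ m ∈ Finset.Icc (mTr M G) m',
        ((m' : ℤ) - (m : ℤ)) * (((G \ S).filter (fun x => mTr M (insert x S) = m)).card : ℤ) := by
    intro S hS
    have hS' := mem_Pc.1 hS
    have hKG := coloopsOf_subset_of_mem_Rq hG hrG hS'.1
    have habs := card_coloops_le_sum_mTr_sub hG hrG hS'.1
    rw [Finset.card_sdiff_of_subset hKG] at habs
    have hmm : (((coloopsOf M S).card - (coloopsOf M G).card : ℕ) : ℤ) = (m' : ℤ) - (mTr M G : ℤ) := by
      rw [Nat.cast_sub (Finset.card_le_card hKG)]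
      unfold mTr
      rw [← hS'.2.2]
      rfl
    rw [hmm] at habs
    refine habs.trans (le_of_eq ?_)
    rw [← Finset.sum_fiberwise_of_maps_to (s := G \ S) (t := Finset.Icc (mTr M G) m')
      (g := fun x => mTr M (insert x S)) (fun x hx => by
        have hx' := Finset.mem_sdiff.1 hx
        exact Finset.mem_coe.2 (Finset.mem_Icc.2 ⟨mTr_le_of_mem_Rq hG hrG (insert_mem_Rq hrG hS'.1 hx'.1),
          hS'.2.2 ▸ mTr_insert_le_of_mem_Rq hG hrG hS'.1 hx'.1 hx'.2⟩))]
    apply Finset.sum_congr rfl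
    intro m _
    rw [Finset.sum_congr rfl (fun x hx => by
      rw [(Finset.mem_filter.1 hx).2, hS'.2.2]), Finset.sum_const, nsmul_eq_mul]
    ring
  unfold mv
  push_cast
  calc ((m' : ℤ) - (mTr M G : ℤ)) * ((Pc M G q (k + 1) m').card : ℤ)
      = ∑ S ∈ Pc M G q (k + 1) m', ((m' : ℤ) - (mTr M G : ℤ)) := by
        rw [Finset.sum_const, nsmul_eq_mul, mul_comm]
    _ ≤ ∑ S ∈ Pc M G q (k + 1) m', ∑ m ∈ Finset.Icc (mTr M G) m',
          ((m' : ℤ) - (m : ℤ)) * (((G \ S).filter (fun x => mTr M (insert x S) = m)).card : ℤ) :=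
        Finset.sum_le_sum key
    _ = ∑ m ∈ Finset.Icc (mTr M G) m', ((m' : ℤ) - (m : ℤ)) *
          ∑ S ∈ Pc M G q (k + 1) m', (((G \ S).filter (fun x => mTr M (insert x S) = m)).card : ℤ) := by
        rw [Finset.sum_comm]
        simp_rw [Finset.mul_sum]

/-! ## Grouping the lines by their number of points in `G` -/

/-- `B_ℓ = Σ_{L ∈ lines M, |L ∩ G| = ℓ} betaL`. -/
noncomputable def Bl (M : Matroid α) [M.Finite] (G : Finset α) (q l : ℕ) : ℕ :=
  ∑ L ∈ (lines M).filter (fun L : Finset α => (L ∩ G).card = l), betaL M G L q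

/-- `N_ℓ = #{L ∈ lines M : |L ∩ G| = ℓ}`. -/
noncomputable def Nl (M : Matroid α) [M.Finite] (G : Finset α) (l : ℕ) : ℕ :=
  ((lines M).filter (fun L : Finset α => (L ∩ G).card = l)).card

/-- A sum over the lines of `f(|L ∩ G|)·betaL` is `Σ_ℓ f(ℓ)·B_ℓ` (`ℓ ≤ |G|`). -/
theorem sum_lines_mul_betaL_eq (G : Finset α) (q : ℕ) (f : ℕ → ℕ) :
    ∑ L ∈ lines M, f (L ∩ G).card * betaL M G L q =
      ∑ l ∈ Finset.range (G.card + 1), f l * Bl M G q l := by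
  rw [← Finset.sum_fiberwise_of_maps_to (s := lines M) (t := Finset.range (G.card + 1))
    (g := fun L : Finset α => (L ∩ G).card) (fun L _ => Finset.mem_coe.2 (Finset.mem_range.2
      (Nat.lt_succ_of_le (Finset.card_le_card Finset.inter_subset_right))))]
  apply Finset.sum_congr rfl
  intro l _
  unfold Bl
  rw [Finset.mul_sum]
  apply Finset.sum_congr rfl
  intro L hL
  rw [(Finset.mem_filter.1 hL).2]

/-- `B_ℓ ≤ C(|G| − ℓ, q − 2)·N_ℓ`. -/
theorem Bl_le (G : Finset α) (q l : ℕ) : Bl M G q l ≤ (G.card - l).choose (q - 2) * Nl M G l := by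
  unfold Bl Nl
  rw [Finset.card_eq_sum_ones ((lines M).filter (fun L : Finset α => (L ∩ G).card = l)), Finset.mul_sum]
  apply Finset.sum_le_sum
  intro L hL
  have hl := (Finset.mem_filter.1 hL).2
  have h := betaL_le (M := M) G L q
  have hsd : (G \ L).card = G.card - (L ∩ G).card := by
    have h2 := Finset.card_sdiff_add_card_inter G L
    rw [Finset.inter_comm] at h2
    omega
  rw [hsd, hl] at h
  rw [mul_one]
  exact h

/-- `#lineSub G L = Σ_{j ∈ [3, |L ∩ G| − 2]} C(|L ∩ G|, j)`. -/
theorem card_lineSub_eq (G L : Finset α) :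
    (lineSub G L).card = ∑ j ∈ Finset.Icc 3 ((L ∩ G).card - 2), (L ∩ G).card.choose j := by
  rw [Finset.card_eq_sum_card_fiberwise (s := lineSub G L) (t := Finset.Icc 3 ((L ∩ G).card - 2))
    (f := fun A : Finset α => A.card) (fun A hA => by
      obtain ⟨-, h3, h2⟩ := mem_lineSub.1 hA
      exact Finset.mem_coe.2 (Finset.mem_Icc.2 ⟨h3, (by omega : A.card ≤ (L ∩ G).card - 2)⟩))]
  apply Finset.sum_congr rfl
  intro j hj
  rw [Finset.mem_Icc] at hj
  rw [← Finset.card_powersetCard]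
  congr 1
  ext A
  rw [Finset.mem_filter, mem_lineSub, Finset.mem_powersetCard]
  constructor
  · rintro ⟨⟨hA, -, -⟩, hc⟩
    exact ⟨hA, hc⟩
  · rintro ⟨hA, hc⟩
    exact ⟨⟨hA, by omega, by omega⟩, hc⟩

/-- `Σ_{L ∈ lines M} #lineSub G L = Σ_ℓ c(ℓ)·N_ℓ` with `c(ℓ) = Σ_{j ∈ [3, ℓ − 2]} C(ℓ, j)`. -/
theorem sum_card_lineSub_eq (G : Finset α) :
    ∑ L ∈ lines M, (lineSub G L).card =
      ∑ l ∈ Finset.range (G.card + 1), (∑ j ∈ Finset.Icc 3 (l - 2), l.choose j) * Nl M G l := by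
  rw [← Finset.sum_fiberwise_of_maps_to (s := lines M) (t := Finset.range (G.card + 1))
    (g := fun L : Finset α => (L ∩ G).card) (fun L _ => Finset.mem_coe.2 (Finset.mem_range.2
      (Nat.lt_succ_of_le (Finset.card_le_card Finset.inter_subset_right))))]
  apply Finset.sum_congr rfl
  intro l _
  unfold Nl
  rw [Finset.card_eq_sum_ones, Finset.mul_sum]
  apply Finset.sum_congr rfl
  intro L hL
  rw [card_lineSub_eq, (Finset.mem_filter.1 hL).2, mul_one]

end PercRepro.Star
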